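import Mathlib
import HarnessLib
import Summits.HubbardSuperconductivity.HubbardSuperconductivity.Theorems.KLProgrammeKLRegimeTwoVolumeLipDoubledDoorData
import Summits.HubbardSuperconductivity.HubbardSuperconductivity.Theorems.KLProgrammeKLRegimeTwoVolumeLipBlockStepDeepRate

/-!
# Route `KLProgramme` — crux K3 ENGINE (stmt-HubbardSuperconductivity-20437), stub (e) proof-input «(e)-D-ROWS», keying (A′), REKEY-D file D2:
# THE DEEP BLOCK-STEP DOOR OF THE DOUBLED (plain-track) TWO-VOLUME LIPSCHITZ TOWER AT THE MODEL OBJECTS, free weight rate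
# (seat hubbard-kl-k3c4-p1 g27; design map HOME/hubbard-kl-k3c4-p1/REKEY-D.md §2 «LIP door⁺»; doubled twin of ✓ `…TwoVolumeLipBlockStepDeepRate.lipBlockStep_deep_rate_le`)

By the doubled block identity (D1 `klLipBornD_eq_map_step`: `klLipBornD = map (toLin' T⁺) (effAction (C ⊕ 0) (klLipInputD) − klLipInputD)`, NO synthesis) the generic deep door
`TwoVolumeDefect.sum_pinned_norm_kernel_map_born_sub_born_le_of_deep` is read at `(f, C, g) := (id, klLipCovD, toLin' klLipTransferD)` on the doubled labels
`SrcLabel (bL) M (dk−1)`, with `V := klGlueD (klLipInputD L … d k)`, `D := klLipInputDiffD`, the glued tree weight read through `Prod.fst`, the deep region `klDeepPinsD L R` and the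
near columns `Near` read on the position-sector component.  The data are those of the sector door in the doubled reading (D2a `…TwoVolumeLipDoubledDoorData`: Gram of `C ⊕ 0`,
weighted rows of `C ⊕ 0`, columns/rows of `T ⊕ shift`, parity); at a PLAIN pin (`w″.2 = 1`) the transfer row is the plain shift (`≤ 1 ≤ a`), whose partner column must be `Near`.

* **`lipBlockStepD_deep_rate_le`** — the pinned profiles of the LIPSCHITZ part of `klLipBornDiffD` (D1 `klLipBornDiffD_eq_lip_add_src`) at any pin `w″` of either copy, bounded by the
  verbatim right-hand side of the generic door with `Γ′ := SrcLabel (bL) M (dk−1)`.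

Composition of landed theorems; the profiles `NV, ND, E`, the covariance data `κ, α` and the transfer data `a, τ` are hypotheses; nothing asserts the (D) rows, (e), VL, K3 or
superconductivity.  References: BGM 2006 (2.61)–(2.63), (2.77)–(2.90), §2.9 (4.3)–(4.6), §3 [cite: BenfattoGiulianiMastropietro2006]; Gawȩdzki–Kupiainen 1985 §3.
-/

noncomputable section

namespace Summit.HubbardSuperconductivity.HubbardSuperconductivity.Theorems.TwoVolumeLip

set_option linter.dupNamespace false -- summit = problem name (single-conjunct summit), D-0017

open Finset Literature.MathematicalPhysics.QuantumLattice GrassmannAlgebra Literature.Probability.LatticeModels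
open Literature.MathematicalPhysics.QuantumLattice.FermiRG
open Summit.HubbardSuperconductivity.HubbardSuperconductivity.Theorems.KLRegimeSplit
open Summit.HubbardSuperconductivity.HubbardSuperconductivity.Theorems.KLProgrammeLegKernels
open Summit.HubbardSuperconductivity.HubbardSuperconductivity.Theorems.EngineV8
open Summit.HubbardSuperconductivity.HubbardSuperconductivity.Theorems.TwoVolumeSource
open Summit.HubbardSuperconductivity.HubbardSuperconductivity.Theorems.TwoVolumeDefect


/-! ## D2 THE DEEP BLOCK-STEP DOOR OF THE DOUBLED TOWER AT THE MODEL OBJECTS (reading `(f, C, g) = (id, klLipCov ⊕ 0, toLin' klLipTransferD)`) -/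

section DoorD

open Literature.Probability.LatticeModels.BattleFederbush

variable {L b M : ℕ} [NeZero L] [NeZero (b * L)] [NeZero M]
set_option maxHeartbeats 400000 in
/-- **THE DEEP BLOCK-STEP DOOR OF THE DOUBLED (plain-track) TWO-VOLUME LIPSCHITZ TOWER AT THE MODEL OBJECTS** (block `k`, `1 ≤ dk`, fine torus `bL`, coarse `L`, common frame `K`,
glued weight at any rate `j_w` read through `Prod.fst`, deep region `klDeepPinsD L R`, near columns `Near` read on the position-sector component and `(R+R′)`-deep, admissible zone
constant `0 < Λ ≤ 1 + Λ_{j_w}(R′+1)`, transfer columns `≤ a` with `1 ≤ a`; at a PLAIN pin (`w″.2 = 1`) the pin's partner column is `Near`).  The generic door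
`TwoVolumeDefect.sum_pinned_norm_kernel_map_born_sub_born_le_of_deep` at `(f, C, g) = (id, klLipCovD, toLin' klLipTransferD)`, `V = klGlueD (klLipInputD L)`, `D = klLipInputDiffD`;
its left side is the LIPSCHITZ part of `klLipBornDiffD` (D1 `klLipBornDiffD_eq_lip_add_src`). [cite: BenfattoGiulianiMastropietro2006, §2.7 (2.70)-(2.71), §3 (3.2)-(3.8)] -/
theorem lipBlockStepD_deep_rate_le {β : ℝ} (hβ : 0 < β) (U μ : ℝ) (K : TrigPolyC4v) {d k jw : ℕ}
    (hZf : hubbardEffPartitionFnCT (b * L) M β U μ 0 K (klScale klE0 (d * k)) ≠ 0)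
    (hZc : hubbardEffPartitionFnCT L M β U μ 0 K (klScale klE0 (d * k)) ≠ 0)
    {κ : ℝ} (hκ : 0 < κ) (hGB : IsGramBoundedR (klLipCov (b * L) M β μ K d k) κ)
    (NV ND E : ℕ → ℝ) (hNV0 : ∀ m', 0 ≤ NV m') (hND0 : ∀ m', 0 ≤ ND m') (hE0 : ∀ m', 0 ≤ E m')
    (hNV : ∀ m' (j : Fin (2 * m')) (x : SrcLabel (b * L) M (d * k - 1)), ∑ Y ∈ univ.filter (fun Y : Fin (2 * m') → SrcLabel (b * L) M (d * k - 1) => Y j = x),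
      ‖kernel ℂ (klGlueD L b M (d * k - 1) (klLipInputD L M β U μ K d k)) (2 * m') Y‖ *
        klGluedWt L b M β jw (sectorCount (d * k - 1)) ((univ.image Y).image Prod.fst) ≤ NV m')
    (hND : ∀ m' (j : Fin (2 * m')) (x : SrcLabel (b * L) M (d * k - 1)), ∑ Y ∈ univ.filter (fun Y : Fin (2 * m') → SrcLabel (b * L) M (d * k - 1) => Y j = x),
      ‖kernel ℂ (klLipInputDiffD L b M β U μ K d k) (2 * m') Y‖ * klGluedWt L b M β jw (sectorCount (d * k - 1)) ((univ.image Y).image Prod.fst) ≤ ND m')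
    (R R' : ℕ)
    (hE : ∀ m' (j : Fin (2 * m')) (x : SrcLabel (b * L) M (d * k - 1)), x ∈ klDeepPinsD (V := b * L) (M := M) (n := d * k - 1) L R →
      ∑ Y ∈ univ.filter (fun Y : Fin (2 * m') → SrcLabel (b * L) M (d * k - 1) => Y j = x), ‖kernel ℂ (klLipInputDiffD L b M β U μ K d k) (2 * m') Y‖ ≤ E m')
    {α : ℝ} (hα : 0 < α)
    (hrow : ∀ X, ∑ Y, ‖klLipCov (b * L) M β μ K d k X Y‖ * klGluedWt L b M β jw (sectorCount (d * k - 1)) {X, Y} ≤ α)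
    (hcol : ∀ Y, ∑ X, ‖klLipCov (b * L) M β μ K d k X Y‖ * klGluedWt L b M β jw (sectorCount (d * k - 1)) {X, Y} ≤ α)
    {ρ : ℝ} (hρ : 0 < ρ)
    (hθ₁ : Real.exp 1 * α * normV (SrcLabel (b * L) M (d * k - 1)) κ ρ (fun m' => NV m' + ND m' + E m') / κ ^ 2 < 1)
    (hθ₂ : Real.exp 1 * α * normV (SrcLabel (b * L) M (d * k - 1)) κ ρ (fun m' => NV m' + ND m') / κ ^ 2 < 1)
    {N₀ : ℕ} (hN₀ : 2 ≤ N₀)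
    (Near : (SpaceTimeIdx (b * L) M × SectorLeg (sectorCount (d * k - 1))) → Prop) [DecidablePred Near] (hNear : ∀ y', Near y' → y' ∈ klDeepPins L (R + R'))
    {a τ : ℝ} (ha1 : 1 ≤ a) (hτ0 : 0 ≤ τ)
    (hcolH : ∀ y', ∑ x'', ‖klLipTransfer (b * L) M β μ K d k x'' y'‖ ≤ a) (w'' : SrcLabel (b * L) M (d * k))
    (hrowH : ∑ y' ∈ univ.filter (fun y' => Near y'), ‖klLipTransfer (b * L) M β μ K d k w''.1 y'‖ ≤ a)
    (hτH : ∑ y' ∈ univ.filter (fun y' => ¬ Near y'), ‖klLipTransfer (b * L) M β μ K d k w''.1 y'‖ ≤ τ)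
    (hW : w''.2 = 1 → ∀ y, klPlainShift (b * L) M (sectorCount (d * k)) (sectorCount (d * k - 1)) w''.1 y ≠ 0 → Near y)
    {Λ : ℝ} (hΛ0 : 0 < Λ) (hΛle : Λ ≤ 1 + klScale klE0 jw * ((R' : ℝ) + 1))
    {q : ℕ} (i : Fin (2 * q)) :
    ∑ X'' ∈ univ.filter (fun X'' : Fin (2 * q) → SrcLabel (b * L) M (d * k) => X'' i = w''),
        ‖kernel ℂ (ExteriorAlgebra.map (Matrix.toLin' (klLipTransferD (b * L) M β μ K d k))
          ((effAction ℂ (klLipCovD (b * L) M β μ K d k)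
                (klGlueD L b M (d * k - 1) (klLipInputD L M β U μ K d k) + klLipInputDiffD L b M β U μ K d k) -
              (klGlueD L b M (d * k - 1) (klLipInputD L M β U μ K d k) + klLipInputDiffD L b M β U μ K d k)) -
            (effAction ℂ (klLipCovD (b * L) M β μ K d k) (klGlueD L b M (d * k - 1) (klLipInputD L M β U μ K d k)) -
              klGlueD L b M (d * k - 1) (klLipInputD L M β U μ K d k)))) (2 * q) X''‖ ≤
      a ^ (2 * q - 1) * (a *
        ((∑ m' ∈ range (Fintype.card (SrcLabel (b * L) M (d * k - 1)) / 2 + 1), if q < m' then ((2 * m').choose (2 * q) : ℝ) * κ ^ (2 * m' - 2 * q) * E m' else 0) +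
          Λ⁻¹ * ∑ m' ∈ range (Fintype.card (SrcLabel (b * L) M (d * k - 1)) / 2 + 1),
            if q < m' then ((2 * m').choose (2 * q) : ℝ) * κ ^ (2 * m' - 2 * q) * ND m' else 0) +
        τ * ∑ m' ∈ range (Fintype.card (SrcLabel (b * L) M (d * k - 1)) / 2 + 1), if q < m' then ((2 * m').choose (2 * q) : ℝ) * κ ^ (2 * m' - 2 * q) * ND m' else 0) +
      a ^ (2 * q - 1) * (a *
        ((∑ n ∈ Ico 2 N₀, (ρ⁻¹ ^ (2 * q) * κ⁻¹ ^ (2 * (n - 1)) * (α ^ (n - 1) * Real.exp n)) *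
            ∑ δ ∈ (Fintype.piFinset fun _ : Fin n => range (Fintype.card (SrcLabel (b * L) M (d * k - 1)) / 2 + 1)) with 2 * q + 2 * (n - 1) ≤ ∑ a, 2 * δ a,
              ∑ a, (Real.exp 2 * (κ + ρ)) ^ (2 * δ a) * E (δ a) *
                ∏ b ∈ univ.erase a, (Real.exp 2 * (κ + ρ)) ^ (2 * δ b) * (NV (δ b) + ND (δ b) + E (δ b)) +
          2 * (ρ⁻¹ ^ (2 * q) * (Real.exp 1 * normV (SrcLabel (b * L) M (d * k - 1)) κ ρ (fun m' => NV m' + ND m' + E m')) *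
            (Real.exp 1 * α * normV (SrcLabel (b * L) M (d * k - 1)) κ ρ (fun m' => NV m' + ND m' + E m') / κ ^ 2) ^ (N₀ - 1) /
              (1 - Real.exp 1 * α * normV (SrcLabel (b * L) M (d * k - 1)) κ ρ (fun m' => NV m' + ND m' + E m') / κ ^ 2))) +
        Λ⁻¹ * (∑ n ∈ Ico 2 N₀, (ρ⁻¹ ^ (2 * q) * κ⁻¹ ^ (2 * (n - 1)) * (α ^ (n - 1) * Real.exp n)) *
            ∑ δ ∈ (Fintype.piFinset fun _ : Fin n => range (Fintype.card (SrcLabel (b * L) M (d * k - 1)) / 2 + 1)) with 2 * q + 2 * (n - 1) ≤ ∑ a, 2 * δ a,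
              ∑ a, (Real.exp 2 * (κ + ρ)) ^ (2 * δ a) * ND (δ a) *
                ∏ b ∈ univ.erase a, (Real.exp 2 * (κ + ρ)) ^ (2 * δ b) * (NV (δ b) + ND (δ b)) +
          Λ * (2 * (ρ⁻¹ ^ (2 * q) * (Real.exp 1 * normV (SrcLabel (b * L) M (d * k - 1)) κ ρ (fun m' => NV m' + ND m')) *
            (Real.exp 1 * α * normV (SrcLabel (b * L) M (d * k - 1)) κ ρ (fun m' => NV m' + ND m') / κ ^ 2) ^ (N₀ - 1) /
              (1 - Real.exp 1 * α * normV (SrcLabel (b * L) M (d * k - 1)) κ ρ (fun m' => NV m' + ND m') / κ ^ 2))))) +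
        τ * (∑ n ∈ Ico 2 N₀, (ρ⁻¹ ^ (2 * q) * κ⁻¹ ^ (2 * (n - 1)) * (α ^ (n - 1) * Real.exp n)) *
            ∑ δ ∈ (Fintype.piFinset fun _ : Fin n => range (Fintype.card (SrcLabel (b * L) M (d * k - 1)) / 2 + 1)) with 2 * q + 2 * (n - 1) ≤ ∑ a, 2 * δ a,
              ∑ a, (Real.exp 2 * (κ + ρ)) ^ (2 * δ a) * ND (δ a) *
                ∏ b ∈ univ.erase a, (Real.exp 2 * (κ + ρ)) ^ (2 * δ b) * (NV (δ b) + ND (δ b)) +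
          2 * (ρ⁻¹ ^ (2 * q) * (Real.exp 1 * normV (SrcLabel (b * L) M (d * k - 1)) κ ρ (fun m' => NV m' + ND m')) *
            (Real.exp 1 * α * normV (SrcLabel (b * L) M (d * k - 1)) κ ρ (fun m' => NV m' + ND m') / κ ^ 2) ^ (N₀ - 1) /
              (1 - Real.exp 1 * α * normV (SrcLabel (b * L) M (d * k - 1)) κ ρ (fun m' => NV m' + ND m') / κ ^ 2)))) := by
  classical
  have h10 : ¬ ((1 : Fin 2) = 0) := by decide
  -- parity and constant parts
  have hIc : klTowerInput L M β U μ K d k ∈ evenOdd ℂ 0 :=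
    Summit.HubbardSuperconductivity.HubbardSuperconductivity.Theorems.KLRegimeWick.klEffectiveAction_mem_evenOdd_zero β U μ K klE0 (d * k)
  have hIf : klTowerInput (b * L) M β U μ K d k ∈ evenOdd ℂ 0 :=
    Summit.HubbardSuperconductivity.HubbardSuperconductivity.Theorems.KLRegimeWick.klEffectiveAction_mem_evenOdd_zero β U μ K klE0 (d * k)
  have hIc0 : constPart ℂ (klTowerInput L M β U μ K d k) = 0 := constPart_klEffectiveAction_eq_zero β U μ K klE0 (d * k) hZc
  have hIf0 : constPart ℂ (klTowerInput (b * L) M β U μ K d k) = 0 := constPart_klEffectiveAction_eq_zero β U μ K klE0 (d * k) hZf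
  have hVe : klGlueD L b M (d * k - 1) (klLipInputD L M β U μ K d k) ∈ evenPart ℂ (SrcLabel (b * L) M (d * k - 1)) :=
    klGlueD_mem_evenOdd_zero (klLipInputD_mem_evenOdd_zero hIc)
  have hV0 : constPart ℂ (klGlueD L b M (d * k - 1) (klLipInputD L M β U μ K d k)) = 0 :=
    constPart_klGlueD (by rw [constPart_klLipInputD, hIc0])
  have hDe : klLipInputDiffD L b M β U μ K d k ∈ evenPart ℂ (SrcLabel (b * L) M (d * k - 1)) := klLipInputDiffD_mem_evenOdd_zero hIf hIc
  have hD0 : constPart ℂ (klLipInputDiffD L b M β U μ K d k) = 0 := constPart_klLipInputDiffD hIf0 hIc0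
  -- the weight read through `Prod.fst`
  set wt : Finset (SrcLabel (b * L) M (d * k - 1)) → ℝ := fun S => klGluedWt L b M β jw (sectorCount (d * k - 1)) (S.image Prod.fst) with hwt_def
  have hwt : IsTreeWeight wt := (isTreeWeight_klGluedWt (L := L) (b := b) (M := M) hβ.le jw (sectorCount (d * k - 1))).comap Prod.fst
  have hΛ : ∀ y' : SrcLabel (b * L) M (d * k - 1), Near y'.1 → ∀ Sset : Finset (SrcLabel (b * L) M (d * k - 1)), y' ∈ Sset →
      (∃ z ∈ Sset, ¬ z ∈ klDeepPinsD (V := b * L) (M := M) (n := d * k - 1) L R) → Λ ≤ wt Sset := by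
    intro y' hy' Sset hyS hz
    obtain ⟨z, hzS, hzR⟩ := hz
    rw [mem_klDeepPinsD] at hzR
    exact hΛle.trans (klGluedWt_ge_of_deep_of_not_deep hβ.le jw (Finset.mem_image_of_mem _ hyS) (Finset.mem_image_of_mem _ hzS) (hNear _ hy') hzR)
  -- the substitutions: `f = id`, `g = toLin' T⁺`
  set f : (SrcLabel (b * L) M (d * k - 1) → ℂ) →ₗ[ℂ] (SrcLabel (b * L) M (d * k - 1) → ℂ) := LinearMap.id with hf
  set g : (SrcLabel (b * L) M (d * k - 1) → ℂ) →ₗ[ℂ] (SrcLabel (b * L) M (d * k) → ℂ) := Matrix.toLin' (klLipTransferD (b * L) M β μ K d k) with hg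
  have hfm : LinearMap.toMatrix' f = 1 := by rw [hf, LinearMap.toMatrix'_id]
  have hfCf : (LinearMap.toMatrix' f).transpose * klLipCovD (b * L) M β μ K d k * LinearMap.toMatrix' f = klLipCovD (b * L) M β μ K d k := by
    rw [hfm, Matrix.transpose_one, Matrix.one_mul, Matrix.mul_one]
  have hgf : LinearMap.toMatrix' (g ∘ₗ f) = klLipTransferD (b * L) M β μ K d k := by
    rw [hf, LinearMap.comp_id, hg, LinearMap.toMatrix'_toLin']
  -- data in the doubled reading
  have hGBD : IsGramBoundedR ((LinearMap.toMatrix' f).transpose * klLipCovD (b * L) M β μ K d k * LinearMap.toMatrix' f) κ := by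
    rw [hfCf]; exact isGramBoundedR_klLipCovD hGB
  have hrowD : ∀ X : SrcLabel (b * L) M (d * k - 1), ∑ Y, ‖((LinearMap.toMatrix' f).transpose * klLipCovD (b * L) M β μ K d k * LinearMap.toMatrix' f) X Y‖ * wt {X, Y} ≤ α := by
    intro X; rw [hfCf]
    exact rowSum_spectator_wt_le _ _ hα.le hrow _ (klLipCovD_apply β μ K d k) X
  have hcolD : ∀ Y : SrcLabel (b * L) M (d * k - 1), ∑ X, ‖((LinearMap.toMatrix' f).transpose * klLipCovD (b * L) M β μ K d k * LinearMap.toMatrix' f) X Y‖ * wt {X, Y} ≤ α := by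
    intro Y; rw [hfCf]
    exact colSum_spectator_wt_le _ _ hα.le hcol _ (klLipCovD_apply β μ K d k) Y
  have hcolHD : ∀ y' : SrcLabel (b * L) M (d * k - 1), ∑ x'', ‖LinearMap.toMatrix' (g ∘ₗ f) x'' y'‖ ≤ a := by
    intro y'; rw [hgf]
    exact colSum_doubleBlock_le _ _ _ (klLipTransferD_apply β μ K d k) hcolH
      (colSum_norm_klPlainShift_le_one (sectorCount_pos _)) ha1 y'
  have hrowHD : ∑ y' ∈ univ.filter (fun y' : SrcLabel (b * L) M (d * k - 1) => Near y'.1), ‖LinearMap.toMatrix' (g ∘ₗ f) w'' y'‖ ≤ a := by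
    rw [hgf]
    rcases Fin.exists_fin_two.1 ⟨w''.2, rfl⟩ with h | h
    · rw [rowSum_doubleBlock_filter_copy0 _ _ _ (klLipTransferD_apply β μ K d k) Near w'' h]; exact hrowH
    · exact (rowSum_doubleBlock_filter_copy1_le _ _ _ (klLipTransferD_apply β μ K d k)
        (fun x s => rowSum_norm_klPlainShift_le_one (sectorCount_pos _) x s) _ w'' h).trans ha1
  have hτHD : ∑ y' ∈ univ.filter (fun y' : SrcLabel (b * L) M (d * k - 1) => ¬ Near y'.1), ‖LinearMap.toMatrix' (g ∘ₗ f) w'' y'‖ ≤ τ := by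
    rw [hgf]
    rcases Fin.exists_fin_two.1 ⟨w''.2, rfl⟩ with h | h
    · rw [rowSum_doubleBlock_filter_copy0 _ _ _ (klLipTransferD_apply β μ K d k) (fun y => ¬ Near y) w'' h]; exact hτH
    · refine le_trans (le_of_eq (Finset.sum_eq_zero fun y' hy' => ?_)) hτ0
      rw [Finset.mem_filter] at hy'
      rw [klLipTransferD_apply, h]
      simp only [h10, false_and, if_false, true_and]
      by_cases hy2 : y'.2 = 1
      · rw [if_pos hy2]
        by_contra hne
        exact hy'.2 (hW h y'.1 (fun h0 => hne (by rw [h0, norm_zero])))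
      · rw [if_neg hy2, norm_zero]
  have h := sum_pinned_norm_kernel_map_born_sub_born_le_of_deep hwt (klLipCovD (b * L) M β μ K d k) f g hκ hGBD
    (klGlueD L b M (d * k - 1) (klLipInputD L M β U μ K d k)) (klLipInputDiffD L b M β U μ K d k) hVe hDe hV0 hD0 NV ND E hNV0 hND0 hE0
    (fun m' j x => by simpa [hwt_def, Finset.image_image] using hNV m' j x) (fun m' j x => by simpa [hwt_def, Finset.image_image] using hND m' j x)
    (fun x : SrcLabel (b * L) M (d * k - 1) => x ∈ klDeepPinsD (V := b * L) (M := M) (n := d * k - 1) L R) (fun m' j x hx => hE m' j x hx) hα hrowD hcolD hρ hθ₁ hθ₂ hN₀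
    (fun y' : SrcLabel (b * L) M (d * k - 1) => Near y'.1) (a := a) (τ := τ) (le_trans zero_le_one ha1) hcolHD w'' hrowHD hτHD hΛ0 hΛ i
  simpa only [hf, ExteriorAlgebra.map_id, AlgHom.id_apply] using h

end DoorD

end Summit.HubbardSuperconductivity.HubbardSuperconductivity.Theorems.TwoVolumeLip

end
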